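import Mathlib.Analysis.SpecialFunctions.Pow.Real
import Mathlib.Analysis.SpecialFunctions.Log.Basic
import Mathlib.Data.Fintype.BigOperators
import Mathlib.Algebra.Order.Floor.Semifield
import Mathlib.MeasureTheory.Integral.Bochner.Set
import Mathlib.MeasureTheory.Constructions.Pi
import Mathlib.MeasureTheory.Measure.Lebesgue.Basic
import Mathlib.Tactic
import Literature.NumberTheory.Sieve.MaynardTao
import Literature.NumberTheory.Sieve.MaynardSieveWeights
import HarnessLib

/-!
# Equidistribution of product sieve weights on the logarithmic scale

J. Maynard, *Small gaps between primes*, Ann. of Math. (2) 181 (2015), 383–413 = arXiv:1311.4600,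
proves the main terms of Lemmas 6.2 and 6.3 — `∑_{u₁,…,u_k} ∏ᵢ μ²(uᵢ)γ(uᵢ)/… · F(log u₁/log R, …)²
= (φ(W)/W)^k (log R)^k (I_k(F) + o(1))` ((6.9)) and its `J_k^{(m)}` analogue ((6.14)) — by `k`
successive applications of the one-dimensional partial-summation Lemma 6.1 (quoted from
Goldston–Graham–Pintz–Yıldırım). The tree's proof replaces this by a direct `k'`-dimensional
Riemann-sum argument, which needs only the *counting functions* of the one-dimensional weights
(no derivative of `F`): this file.

* `cell R M j` (the integers `u` with `R^{j/M} < u ≤ R^{(j+1)/M}`), `cellIdx`, `cellMass`: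
  if the counting function of a weight `wt ≥ 0` is `c log y (1 + O(ε)) + O(E)` then every cell has
  mass `c (log R)/M` up to `2(ε c log R + E)` (`abs_cellMass_sub_le`);
* `weightedSum wt R G = ∑_{u ∈ maynardBox k' R} (∏ᵢ wtᵢ(uᵢ)) G((log uᵢ/log R)ᵢ)` (the box
  `[1, ⌊R⌋]^{k'}` of `MaynardSieveWeights.lean`; integrals are over the tree's `maynardCube`) and its
  decomposition
  along the `M^{k'}` product cells (`weightedSum_eq_sum_cellVecs`), the comparison with the grid sum
  `∑_j mass(j) v_j` given a classification of cells into good ones (where `G` is within `ω` of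
  `v_j`) and bad ones (`abs_weightedSum_sub_grid_le`), the passage to uniform masses
  (`abs_grid_sub_uniform_le`, product perturbation `abs_prod_sub_pow_le`), and to the integral over
  the unit cube through the tiling by half-open boxes (`integral_maynardCube_eq_sum`,
  `abs_uniform_sub_integral_le`);
* for `G = g · 1_P`, `P = {t ∈ [0,1]^{k'} : ∑_{i ∈ S_l} tᵢ ≤ 1 ∀ l}` a polytope of simplex type
  (`polytope`; `R_k` itself, and the support of the `J`-integrand), the cells inside/outside `P`
  are good with `v_j = g(corner)` resp. `0` (`classify_cells`), and the remaining cells number at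
  most `(∑_l (|S_l| + 1)) M^{k'−1}` (`card_filter_not_good_le`);
* **`abs_weightedSum_sub_integral_le`** (main result): with `η = 2M(ε + E/(c log R))`,
  `|Σ − (c log R)^{k'} ∫_{[0,1]^{k'}} G| ≤ (c log R)^{k'} (((1+η)^{k'} + 1)(ω + 2 Gmax L'/M)
   + Gmax ((1+η)^{k'} − 1))`, `L' = ∑_l (|S_l|+1)`, `ω` the oscillation of `g` at scale `1/M` on the
  cube and `Gmax` its bound. Choosing `M`, then `ε`, then `R` large makes the bracket small.

## References

* J. Maynard, *Small gaps between primes*, Ann. of Math. (2) 181 (2015), 383–413,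
  doi:10.4007/annals.2015.181.1.7 = arXiv:1311.4600; Lemmas 6.1–6.3 and the proofs of Lemmas 6.2,
  6.3 (display numbers quoted in this file, (6.5)–(6.14), are those of the arXiv version v3).
  [cite: MaynardAnnals2015]
-/

open Finset Real

namespace Literature.NumberTheory.Sieve
namespace MaynardTao

/-! ### One-dimensional cells `(R^{j/M}, R^{(j+1)/M}]` -/

section Cells

variable (R : ℝ) (M : ℕ)

/-- The upper threshold `⌊R^{(j+1)/M}⌋` of the `j`-th cell. [folklore] -/
noncomputable def cellUpper (j : ℕ) : ℕ := ⌊R ^ (((j : ℝ) + 1) / M)⌋₊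

/-- The lower threshold of the `j`-th cell: `0` for `j = 0`, `⌊R^{j/M}⌋` otherwise. [folklore] -/
noncomputable def cellLower (j : ℕ) : ℕ := if j = 0 then 0 else ⌊R ^ ((j : ℝ) / M)⌋₊

/-- The `j`-th cell of integers: `u` with `R^{j/M} < u ≤ R^{(j+1)/M}` (and `1 ≤ u ≤ R^{1/M}` for
`j = 0`). [folklore] -/
noncomputable def cell (j : ℕ) : Finset ℕ := Finset.Ioc (cellLower R M j) (cellUpper R M j)

variable {R M}

/-- `cellLower (j+1) = cellUpper j`. [folklore] -/
theorem cellLower_succ (j : ℕ) : cellLower R M (j + 1) = cellUpper R M j := by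
  rw [cellLower, if_neg (Nat.succ_ne_zero j), cellUpper]; push_cast; rfl

/-- The thresholds increase. [folklore] -/
theorem cellUpper_mono (hR : 1 ≤ R) (hM : 0 < M) : Monotone (cellUpper R M) := by
  intro i j hij
  unfold cellUpper
  refine Nat.floor_le_floor (Real.rpow_le_rpow_of_exponent_le hR ?_)
  have : (0:ℝ) < M := by exact_mod_cast hM
  have hij' : (i : ℝ) ≤ j := by exact_mod_cast hij
  exact div_le_div_of_nonneg_right (by linarith) this.le

/-- Cells are well formed. [folklore] -/
theorem cellLower_le_cellUpper (hR : 1 ≤ R) (hM : 0 < M) (j : ℕ) : cellLower R M j ≤ cellUpper R M j := by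
  rcases j with _ | j
  · simp [cellLower]
  · rw [cellLower_succ]; exact cellUpper_mono hR hM (Nat.le_succ j)

/-- The last threshold is `⌊R⌋`. [folklore] -/
theorem cellUpper_pred_M (hM : 0 < M) : cellUpper R M (M - 1) = ⌊R⌋₊ := by
  unfold cellUpper
  congr 1
  have : ((M - 1 : ℕ) : ℝ) + 1 = M := by
    rw [Nat.cast_sub hM]; push_cast; ring
  rw [this, div_self (by exact_mod_cast hM.ne'), Real.rpow_one]

/-- The cells `j < M` partition `[1, ⌊R⌋]`: membership. [folklore] -/
theorem mem_cell_iff {j u : ℕ} : u ∈ cell R M j ↔ cellLower R M j < u ∧ u ≤ cellUpper R M j := Finset.mem_Ioc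

/-- The cell index of `u`: the number of upper thresholds below `u`. [folklore] -/
noncomputable def cellIdx (R : ℝ) (M u : ℕ) : ℕ := ((Finset.range M).filter (fun j => cellUpper R M j < u)).card

/-- Cell indices of `u ≤ R` are `< M`. [folklore] -/
theorem cellIdx_lt (hM : 0 < M) {u : ℕ} (hu : u ≤ ⌊R⌋₊) : cellIdx R M u < M := by
  unfold cellIdx
  have : (Finset.range M).filter (fun j => cellUpper R M j < u) ⊆ Finset.range (M - 1) := by
    intro j hj
    rw [Finset.mem_filter, Finset.mem_range] at hj
    rw [Finset.mem_range]
    by_contra h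
    have hjM : j = M - 1 := by omega
    rw [hjM, cellUpper_pred_M hM] at hj
    omega
  calc _ ≤ (Finset.range (M - 1)).card := Finset.card_le_card this
    _ = M - 1 := Finset.card_range _
    _ < M := Nat.sub_lt hM Nat.one_pos

/-- The thresholds below `u` form an initial segment. [folklore] -/
theorem filter_lt_eq_range (hR : 1 ≤ R) (hM : 0 < M) (u : ℕ) :
    (Finset.range M).filter (fun j => cellUpper R M j < u) = Finset.range (cellIdx R M u) := by
  -- the filter is a down-set of `range M` hence a range
  have hdown : ∀ j ∈ (Finset.range M).filter (fun j => cellUpper R M j < u), ∀ i ≤ j,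
      i ∈ (Finset.range M).filter (fun j => cellUpper R M j < u) := by
    intro j hj i hij
    rw [Finset.mem_filter, Finset.mem_range] at hj ⊢
    exact ⟨lt_of_le_of_lt hij hj.1, lt_of_le_of_lt (cellUpper_mono hR hM hij) hj.2⟩
  set S := (Finset.range M).filter (fun j => cellUpper R M j < u) with hS
  have key : S = Finset.range S.card := by
    apply Finset.eq_of_subset_of_card_le
    · intro j hj
      rw [Finset.mem_range]
      -- all of `0..j` lie in `S`
      have : Finset.range (j + 1) ⊆ S := fun i hi => hdown j hj i (Nat.lt_succ_iff.1 (Finset.mem_range.1 hi))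
      have := Finset.card_le_card this
      rw [Finset.card_range] at this
      omega
    · rw [Finset.card_range]
  rw [key]
  rfl

/-- `u` lies in its cell. [folklore] -/
theorem mem_cell_cellIdx (hR : 1 ≤ R) (hM : 0 < M) {u : ℕ} (hu1 : 1 ≤ u) (hu : u ≤ ⌊R⌋₊) :
    u ∈ cell R M (cellIdx R M u) := by
  have hlt := cellIdx_lt hM hu
  have hS := filter_lt_eq_range hR hM u
  rw [mem_cell_iff]
  constructor
  · -- lower threshold `< u`
    rcases Nat.eq_zero_or_pos (cellIdx R M u) with h0 | hpos
    · rw [h0, cellLower, if_pos rfl]; exact hu1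
    · obtain ⟨i, hi⟩ : ∃ i, cellIdx R M u = i + 1 := ⟨_, (Nat.succ_pred_eq_of_pos hpos).symm⟩
      rw [hi, cellLower_succ]
      have : i ∈ Finset.range (cellIdx R M u) := Finset.mem_range.2 (by omega)
      rw [← hS, Finset.mem_filter] at this
      exact this.2
  · -- upper threshold `≥ u`
    by_contra h
    push Not at h
    have : cellIdx R M u ∈ (Finset.range M).filter (fun j => cellUpper R M j < u) :=
      Finset.mem_filter.2 ⟨Finset.mem_range.2 hlt, h⟩
    rw [hS, Finset.mem_range] at this
    exact lt_irrefl _ this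

/-- The cell index is characterised by membership. [folklore] -/
theorem cellIdx_eq_of_mem_cell (hR : 1 ≤ R) (hM : 0 < M) {u j : ℕ} (hj : j < M) (hu : u ∈ cell R M j) :
    cellIdx R M u = j := by
  rw [mem_cell_iff] at hu
  have hS := filter_lt_eq_range hR hM u
  -- `j ∉ S` and `j - 1 ∈ S`
  have h1 : j ∉ Finset.range (cellIdx R M u) := by
    rw [← hS, Finset.mem_filter]; push Not; intro; exact hu.2
  have h2 : ∀ i < j, i ∈ Finset.range (cellIdx R M u) := by
    intro i hij
    rw [← hS, Finset.mem_filter, Finset.mem_range]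
    refine ⟨lt_trans hij hj, lt_of_le_of_lt ?_ hu.1⟩
    obtain ⟨l, rfl⟩ : ∃ l, j = l + 1 := ⟨j - 1, by omega⟩
    rw [cellLower_succ]
    exact cellUpper_mono hR hM (by omega)
  rw [Finset.mem_range, not_lt] at h1
  rcases Nat.eq_zero_or_pos j with rfl | hpos
  · omega
  · have := h2 (j - 1) (by omega)
    rw [Finset.mem_range] at this
    omega

/-- Elements of a cell `j < M` lie in `[1, ⌊R⌋]`. [folklore] -/
theorem mem_Icc_of_mem_cell (hR : 1 ≤ R) (hM : 0 < M) {u j : ℕ} (hj : j < M) (hu : u ∈ cell R M j) :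
    u ∈ Finset.Icc 1 ⌊R⌋₊ := by
  rw [mem_cell_iff] at hu
  rw [Finset.mem_Icc]
  refine ⟨by omega, hu.2.trans ?_⟩
  rw [← cellUpper_pred_M hM]
  exact cellUpper_mono hR hM (by omega)

/-- Logarithmic position of the members of a cell: `j/M ≤ log u / log R ≤ (j+1)/M`. [folklore] -/
theorem div_le_log_div_of_mem_cell (hR : 1 < R) (hM : 0 < M) {u j : ℕ} (hu : u ∈ cell R M j) :
    (j : ℝ) / M ≤ Real.log u / Real.log R ∧ Real.log u / Real.log R ≤ ((j : ℝ) + 1) / M := by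
  rw [mem_cell_iff] at hu
  have hlogR : 0 < Real.log R := Real.log_pos hR
  have hu1 : 1 ≤ u := by omega
  have hu0 : (0:ℝ) < u := by exact_mod_cast hu1
  constructor
  · rw [div_le_div_iff₀ (by exact_mod_cast hM) hlogR]
    rcases Nat.eq_zero_or_pos j with rfl | hpos
    · simp only [Nat.cast_zero, zero_mul]
      exact mul_nonneg (Real.log_nonneg (by exact_mod_cast hu1)) (by exact_mod_cast hM.le)
    · have hlow : cellLower R M j = ⌊R ^ ((j : ℝ) / M)⌋₊ := by rw [cellLower, if_neg hpos.ne']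
      rw [hlow] at hu
      have : R ^ ((j : ℝ) / M) < u := lt_of_lt_of_le (Nat.lt_floor_add_one _) (by exact_mod_cast hu.1)
      have := Real.log_lt_log (Real.rpow_pos_of_pos (by linarith) _) this
      rw [Real.log_rpow (by linarith)] at this
      have hM' : (0:ℝ) < M := by exact_mod_cast hM
      rw [div_mul_eq_mul_div, div_lt_iff₀ hM'] at this
      linarith
  · rw [div_le_div_iff₀ hlogR (by exact_mod_cast hM)]
    have hu2 : u ≤ cellUpper R M j := hu.2
    unfold cellUpper at hu2
    have : (u : ℝ) ≤ R ^ (((j : ℝ) + 1) / M) :=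
      le_trans (by exact_mod_cast hu2) (Nat.floor_le (Real.rpow_nonneg (by linarith) _))
    have := Real.log_le_log hu0 this
    rw [Real.log_rpow (by linarith)] at this
    have hM' : (0:ℝ) < M := by exact_mod_cast hM
    rw [div_mul_eq_mul_div, le_div_iff₀ hM'] at this
    linarith

/-! ### Cell masses of a weight -/

/-- The counting function `M(n) = ∑_{u ≤ n} wt(u)`. [folklore] -/
noncomputable def massUpTo (wt : ℕ → ℝ) (n : ℕ) : ℝ := ∑ u ∈ Finset.Icc 1 n, wt u

/-- The mass of the `j`-th cell. [folklore] -/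
noncomputable def cellMass (wt : ℕ → ℝ) (R : ℝ) (M j : ℕ) : ℝ := ∑ u ∈ cell R M j, wt u

/-- A cell mass is a difference of two values of the counting function. [folklore] -/
theorem cellMass_eq_sub (wt : ℕ → ℝ) (hR : 1 ≤ R) (hM : 0 < M) (j : ℕ) :
    cellMass wt R M j = massUpTo wt (cellUpper R M j) - massUpTo wt (cellLower R M j) := by
  rw [cellMass, cell, massUpTo, massUpTo, eq_sub_iff_add_eq, add_comm, ← Finset.sum_union]
  · congr 1
    ext u
    simp only [Finset.mem_union, Finset.mem_Icc, Finset.mem_Ioc]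
    have := cellLower_le_cellUpper hR hM j
    omega
  · rw [Finset.disjoint_left]
    intro u h1 h2
    rw [Finset.mem_Icc] at h1; rw [Finset.mem_Ioc] at h2
    omega

/-- **Cell masses from the counting function**: if `|M(⌊y⌋) − c log y| ≤ ε c log y + E` for
`y ≥ 1`, then every cell mass is `c (log R)/M` up to `2(ε c log R + E)`. [folklore] -/
theorem abs_cellMass_sub_le {wt : ℕ → ℝ} {c ε E : ℝ} (hc : 0 ≤ c) (hε : 0 ≤ ε)
    (hwt : ∀ y : ℝ, 1 ≤ y → |massUpTo wt ⌊y⌋₊ - c * Real.log y| ≤ ε * c * Real.log y + E)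
    (hR : 1 < R) (hM : 0 < M) {j : ℕ} (hj : j < M) :
    |cellMass wt R M j - c * Real.log R / M| ≤ 2 * (ε * c * Real.log R + E) := by
  have hlogR : 0 < Real.log R := Real.log_pos hR
  have hR0 : 0 < R := by linarith
  have hM' : (0:ℝ) < M := by exact_mod_cast hM
  -- the bound at a threshold `y = R^{s}`, `0 ≤ s ≤ 1`
  have hth : ∀ s : ℝ, 0 ≤ s → s ≤ 1 →
      |massUpTo wt ⌊R ^ s⌋₊ - c * (s * Real.log R)| ≤ ε * c * Real.log R + E := by
    intro s hs0 hs1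
    have hy : 1 ≤ R ^ s := Real.one_le_rpow hR.le hs0
    have := hwt (R ^ s) hy
    rw [Real.log_rpow hR0] at this
    refine this.trans ?_
    have : ε * c * (s * Real.log R) ≤ ε * c * Real.log R := by
      have : s * Real.log R ≤ Real.log R := by nlinarith
      exact mul_le_mul_of_nonneg_left this (by positivity)
    linarith
  rw [cellMass_eq_sub wt hR.le hM]
  have hup := hth (((j : ℝ) + 1) / M) (by positivity)
    (by rw [div_le_one hM']; exact_mod_cast Nat.succ_le_of_lt hj)
  unfold cellUpper
  rcases Nat.eq_zero_or_pos j with rfl | hpos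
  · have h0 : massUpTo wt 0 = 0 := by simp [massUpTo]
    rw [cellLower, if_pos rfl, h0, sub_zero]
    simp only [Nat.cast_zero, zero_add] at hup ⊢
    have e : c * (1 / (M : ℝ) * Real.log R) = c * Real.log R / M := by ring
    rw [e] at hup
    linarith [abs_nonneg (massUpTo wt ⌊R ^ (1 / (M : ℝ))⌋₊ - c * Real.log R / M)]
  · have hlow := hth ((j : ℝ) / M) (by positivity) (by rw [div_le_one hM']; exact_mod_cast hj.le)
    rw [cellLower, if_neg hpos.ne']
    have e : c * (((j : ℝ) + 1) / M * Real.log R) - c * ((j : ℝ) / M * Real.log R) = c * Real.log R / M := by ring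
    calc |massUpTo wt ⌊R ^ (((j : ℝ) + 1) / M)⌋₊ - massUpTo wt ⌊R ^ ((j : ℝ) / M)⌋₊ - c * Real.log R / M|
        = |(massUpTo wt ⌊R ^ (((j : ℝ) + 1) / M)⌋₊ - c * (((j : ℝ) + 1) / M * Real.log R)) -
            (massUpTo wt ⌊R ^ ((j : ℝ) / M)⌋₊ - c * ((j : ℝ) / M * Real.log R))| := by
          rw [← e]; ring_nf
      _ ≤ _ := abs_sub _ _
      _ ≤ _ := by linarith

end Cells


/-! ### The weighted sum over integer tuples and its grid decomposition -/

section Grid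

variable {k' : ℕ} {R : ℝ} {M : ℕ}

/-- Cell vectors `j ∈ [0, M)^{k'}`. [folklore] -/
def cellVecs (k' M : ℕ) : Finset (Fin k' → ℕ) := Fintype.piFinset fun _ : Fin k' => Finset.range M

/-- The integer tuples whose coordinates lie in the cells `j i`. [folklore] -/
noncomputable def cellBox (R : ℝ) (M : ℕ) (j : Fin k' → ℕ) : Finset (Fin k' → ℕ) :=
  Fintype.piFinset fun i => cell R M (j i)

/-- Logarithmic position `t_u = (log uᵢ / log R)ᵢ` of an integer tuple. [cite: MaynardAnnals2015, proof of Lemma 6.2] -/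
noncomputable def logPos (R : ℝ) (u : Fin k' → ℕ) : Fin k' → ℝ := fun i => Real.log (u i) / Real.log R

/-- **The weighted sum** `Σ = ∑_{u ∈ [1,R]^{k'}} (∏ᵢ wtᵢ(uᵢ)) G(log u₁/log R, …)` — the shape of the
main terms of Maynard's Lemmas 6.2, 6.3 ((6.5), (6.12)). [cite: MaynardAnnals2015, proof of Lemma 6.2] -/
noncomputable def weightedSum (wt : Fin k' → ℕ → ℝ) (R : ℝ) (G : (Fin k' → ℝ) → ℝ) : ℝ :=
  ∑ u ∈ maynardBox k' R, (∏ i, wt i (u i)) * G (logPos R u)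

/-- The closed box `∏ᵢ [jᵢ/M, (jᵢ+1)/M]` of a cell vector. [folklore] -/
def closedBox (M : ℕ) (j : Fin k' → ℕ) : Set (Fin k' → ℝ) :=
  {t | ∀ i, (j i : ℝ) / M ≤ t i ∧ t i ≤ ((j i : ℝ) + 1) / M}

/-- Members of a cell box have logarithmic position in the closed box. [folklore] -/
theorem logPos_mem_closedBox (hR : 1 < R) (hM : 0 < M) {j : Fin k' → ℕ} {u : Fin k' → ℕ}
    (hu : u ∈ cellBox R M j) : logPos R u ∈ closedBox M j := by
  intro i
  exact div_le_log_div_of_mem_cell hR hM (Fintype.mem_piFinset.1 hu i)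

/-- The fibres of the cell-index map are the cell boxes. [folklore] -/
theorem filter_cellIdx_eq_cellBox (hR : 1 ≤ R) (hM : 0 < M) {j : Fin k' → ℕ} (hj : j ∈ cellVecs k' M) :
    (maynardBox k' R).filter (fun u => (fun i => cellIdx R M (u i)) = j) = cellBox R M j := by
  ext u
  rw [Finset.mem_filter, maynardBox, Fintype.mem_piFinset, cellBox, Fintype.mem_piFinset, funext_iff]
  have hjM : ∀ i, j i < M := fun i => Finset.mem_range.1 (Fintype.mem_piFinset.1 hj i)
  constructor
  · rintro ⟨hbox, hidx⟩ i
    rw [← hidx i]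
    have := Finset.mem_Icc.1 (hbox i)
    exact mem_cell_cellIdx hR hM this.1 this.2
  · intro hcell
    refine ⟨fun i => mem_Icc_of_mem_cell hR hM (hjM i) (hcell i), fun i => ?_⟩
    exact cellIdx_eq_of_mem_cell hR hM (hjM i) (hcell i)

/-- **Decomposition of the weighted sum along the cells.** [folklore] -/
theorem weightedSum_eq_sum_cellVecs (wt : Fin k' → ℕ → ℝ) (G : (Fin k' → ℝ) → ℝ) (hR : 1 ≤ R)
    (hM : 0 < M) :
    weightedSum wt R G = ∑ j ∈ cellVecs k' M, ∑ u ∈ cellBox R M j, (∏ i, wt i (u i)) * G (logPos R u) := by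
  rw [weightedSum, ← Finset.sum_fiberwise_of_maps_to (g := fun u i => cellIdx R M (u i)) (t := cellVecs k' M)]
  · refine Finset.sum_congr rfl fun j hj => ?_
    rw [filter_cellIdx_eq_cellBox hR hM hj]
  · intro u hu
    rw [cellVecs, Fintype.mem_piFinset]
    intro i
    rw [Finset.mem_range]
    exact cellIdx_lt hM (Finset.mem_Icc.1 (Fintype.mem_piFinset.1 hu i)).2

/-- The mass of a cell box is the product of the one-dimensional cell masses. [folklore] -/
theorem sum_cellBox_prod (wt : Fin k' → ℕ → ℝ) (j : Fin k' → ℕ) :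
    ∑ u ∈ cellBox R M j, ∏ i, wt i (u i) = ∏ i, cellMass (wt i) R M (j i) := by
  rw [cellBox, ← Finset.prod_univ_sum]; rfl

/-- Cell box masses are nonnegative. [folklore] -/
theorem sum_cellBox_prod_nonneg {wt : Fin k' → ℕ → ℝ} (hwt : ∀ i u, 0 ≤ wt i u) (j : Fin k' → ℕ) :
    0 ≤ ∑ u ∈ cellBox R M j, ∏ i, wt i (u i) :=
  Finset.sum_nonneg fun u _ => Finset.prod_nonneg fun i _ => hwt i (u i)

/-- **Grid comparison** (the discretisation step of the tree's proof of Lemmas 6.2/6.3, replacing the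
`k` applications of Lemma 6.1): if on the good cells `G` is within `ω` of the value `v j`, and
`|G|, |v| ≤ Gmax`, then
`|Σ − ∑_j mass(j) v_j| ≤ ω ∑_j mass(j) + 2 Gmax ∑_{bad j} mass(j)`. [cite: MaynardAnnals2015, proof of Lemma 6.2] -/
theorem abs_weightedSum_sub_grid_le {wt : Fin k' → ℕ → ℝ} (hwt : ∀ i u, 0 ≤ wt i u)
    {G : (Fin k' → ℝ) → ℝ} {v : (Fin k' → ℕ) → ℝ} {Good : (Fin k' → ℕ) → Prop} [DecidablePred Good]
    {ω Gmax : ℝ} (hω : 0 ≤ ω) (hR : 1 < R) (hM : 0 < M)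
    (hgood : ∀ j ∈ cellVecs k' M, Good j → ∀ t ∈ closedBox M j, |G t - v j| ≤ ω)
    (hv : ∀ j ∈ cellVecs k' M, |v j| ≤ Gmax)
    (hG : ∀ j ∈ cellVecs k' M, ∀ t ∈ closedBox M j, |G t| ≤ Gmax) :
    |weightedSum wt R G - ∑ j ∈ cellVecs k' M, (∏ i, cellMass (wt i) R M (j i)) * v j| ≤
      ω * ∑ j ∈ cellVecs k' M, ∏ i, cellMass (wt i) R M (j i) +
        2 * Gmax * ∑ j ∈ (cellVecs k' M).filter (fun j => ¬Good j), ∏ i, cellMass (wt i) R M (j i) := by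
  have hmass : ∀ j : Fin k' → ℕ, 0 ≤ ∏ i, cellMass (wt i) R M (j i) := fun j =>
    Finset.prod_nonneg fun i _ => Finset.sum_nonneg fun u _ => hwt i u
  rw [weightedSum_eq_sum_cellVecs wt G hR.le hM, ← Finset.sum_sub_distrib]
  -- termwise bound with the factor `ω` on good cells and `2 Gmax` on bad cells
  have hterm : ∀ j ∈ cellVecs k' M,
      |∑ u ∈ cellBox R M j, (∏ i, wt i (u i)) * G (logPos R u) - (∏ i, cellMass (wt i) R M (j i)) * v j| ≤
        (if Good j then ω else 2 * Gmax) * ∏ i, cellMass (wt i) R M (j i) := by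
    intro j hj
    rw [← sum_cellBox_prod wt, Finset.sum_mul, ← Finset.sum_sub_distrib, Finset.mul_sum]
    refine (Finset.abs_sum_le_sum_abs _ _).trans (Finset.sum_le_sum fun u hu => ?_)
    have hw : 0 ≤ ∏ i, wt i (u i) := Finset.prod_nonneg fun i _ => hwt i (u i)
    rw [← mul_sub, abs_mul, abs_of_nonneg hw, mul_comm]
    refine mul_le_mul_of_nonneg_right ?_ hw
    split_ifs with hg
    · exact hgood j hj hg _ (logPos_mem_closedBox hR hM hu)
    · have h1 := hG j hj _ (logPos_mem_closedBox hR hM hu)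
      have h2 := hv j hj
      calc |G (logPos R u) - v j| ≤ |G (logPos R u)| + |v j| := abs_sub _ _
        _ ≤ 2 * Gmax := by linarith
  calc _ ≤ ∑ j ∈ cellVecs k' M, |∑ u ∈ cellBox R M j, (∏ i, wt i (u i)) * G (logPos R u) -
          (∏ i, cellMass (wt i) R M (j i)) * v j| := Finset.abs_sum_le_sum_abs _ _
    _ ≤ ∑ j ∈ cellVecs k' M, (if Good j then ω else 2 * Gmax) * ∏ i, cellMass (wt i) R M (j i) :=
        Finset.sum_le_sum hterm
    _ = ω * ∑ j ∈ (cellVecs k' M).filter Good, ∏ i, cellMass (wt i) R M (j i) +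
          2 * Gmax * ∑ j ∈ (cellVecs k' M).filter (fun j => ¬Good j), ∏ i, cellMass (wt i) R M (j i) := by
        rw [← Finset.sum_filter_add_sum_filter_not (cellVecs k' M) Good, Finset.mul_sum, Finset.mul_sum]
        congr 1
        · exact Finset.sum_congr rfl fun j hj => by rw [if_pos (Finset.mem_filter.1 hj).2]
        · exact Finset.sum_congr rfl fun j hj => by rw [if_neg (Finset.mem_filter.1 hj).2]
    _ ≤ _ := by
        refine add_le_add (mul_le_mul_of_nonneg_left ?_ hω) le_rfl
        exact Finset.sum_le_sum_of_subset_of_nonneg (Finset.filter_subset _ _) fun j _ _ => hmass j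

/-- **Product perturbation**: `|xᵢ − a| ≤ η a` for all `i` gives `|∏ xᵢ − a^n| ≤ ((1+η)^n − 1) a^n`.
[folklore] -/
theorem abs_prod_sub_pow_le {n : ℕ} {x : Fin n → ℝ} {a η : ℝ} (ha : 0 ≤ a) (hη : 0 ≤ η)
    (hx : ∀ i, |x i - a| ≤ η * a) : |∏ i, x i - a ^ n| ≤ ((1 + η) ^ n - 1) * a ^ n := by
  induction n with
  | zero => simp
  | succ n ih =>
    rw [Fin.prod_univ_castSucc, pow_succ, pow_succ]
    have ih' := ih (x := fun i => x (Fin.castSucc i)) fun i => hx _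
    have hlast := hx (Fin.last n)
    set P := ∏ i : Fin n, x (Fin.castSucc i)
    have hP : |P| ≤ (1 + η) ^ n * a ^ n := by
      have := abs_sub_abs_le_abs_sub P (a ^ n)
      rw [abs_of_nonneg (pow_nonneg ha n)] at this
      nlinarith [pow_nonneg ha n]
    calc |P * x (Fin.last n) - a ^ n * a| = |P * (x (Fin.last n) - a) + (P - a ^ n) * a| := by ring_nf
      _ ≤ |P * (x (Fin.last n) - a)| + |(P - a ^ n) * a| := abs_add_le _ _
      _ = |P| * |x (Fin.last n) - a| + |P - a ^ n| * a := by rw [abs_mul, abs_mul, abs_of_nonneg ha]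
      _ ≤ (1 + η) ^ n * a ^ n * (η * a) + ((1 + η) ^ n - 1) * a ^ n * a := by
          gcongr
      _ = ((1 + η) ^ (n + 1) - 1) * (a ^ n * a) := by ring

/-- Masses of cell boxes are at most `((1+η) a)^{k'}`. [folklore] -/
theorem prod_cellMass_le {wt : Fin k' → ℕ → ℝ} (hwt : ∀ i u, 0 ≤ wt i u) {a η : ℝ}
    (hx : ∀ i, ∀ j < M, |cellMass (wt i) R M j - a| ≤ η * a) {j : Fin k' → ℕ} (hj : j ∈ cellVecs k' M) :
    ∏ i, cellMass (wt i) R M (j i) ≤ ((1 + η) * a) ^ k' := by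
  calc ∏ i, cellMass (wt i) R M (j i) ≤ ∏ _i : Fin k', ((1 + η) * a) :=
        Finset.prod_le_prod (fun i _ => Finset.sum_nonneg fun u _ => hwt i u) fun i _ => ?_
    _ = ((1 + η) * a) ^ k' := by rw [Finset.prod_const, Finset.card_univ, Fintype.card_fin]
  have := hx i (j i) (Finset.mem_range.1 (Fintype.mem_piFinset.1 hj i))
  have := (abs_le.1 this).2
  linarith

/-- **From cell masses to the uniform grid**: replacing each mass by `a^{k'}` costs at most
`M^{k'} Gmax ((1+η)^{k'} − 1) a^{k'}`. [folklore] -/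
theorem abs_grid_sub_uniform_le {wt : Fin k' → ℕ → ℝ} {v : (Fin k' → ℕ) → ℝ} {a η Gmax : ℝ}
    (ha : 0 ≤ a) (hη : 0 ≤ η) (hx : ∀ i, ∀ j < M, |cellMass (wt i) R M j - a| ≤ η * a)
    (hv : ∀ j ∈ cellVecs k' M, |v j| ≤ Gmax) :
    |∑ j ∈ cellVecs k' M, (∏ i, cellMass (wt i) R M (j i)) * v j - ∑ j ∈ cellVecs k' M, a ^ k' * v j| ≤
      (M : ℝ) ^ k' * Gmax * (((1 + η) ^ k' - 1) * a ^ k') := by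
  rw [← Finset.sum_sub_distrib]
  calc _ ≤ ∑ j ∈ cellVecs k' M, |(∏ i, cellMass (wt i) R M (j i)) * v j - a ^ k' * v j| :=
        Finset.abs_sum_le_sum_abs _ _
    _ ≤ ∑ j ∈ cellVecs k' M, Gmax * (((1 + η) ^ k' - 1) * a ^ k') := by
        refine Finset.sum_le_sum fun j hj => ?_
        rw [← sub_mul, abs_mul, mul_comm]
        refine mul_le_mul (hv j hj) ?_ (abs_nonneg _) ((abs_nonneg _).trans (hv j hj))
        exact abs_prod_sub_pow_le ha hη fun i => hx i (j i) (Finset.mem_range.1 (Fintype.mem_piFinset.1 hj i))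
    _ = _ := by
        rw [Finset.sum_const, nsmul_eq_mul, cellVecs, Fintype.card_piFinset]
        simp only [Finset.card_range, Finset.prod_const, Finset.card_univ, Fintype.card_fin]
        push_cast; ring

end Grid


/-! ### The integral side: half-open boxes partition the unit cube -/

section Integral

open MeasureTheory Set

variable {k' : ℕ} {M : ℕ}

/-- The half-open box `∏ᵢ [jᵢ/M, (jᵢ+1)/M)` of a cell vector. [folklore] -/
def hoBox (M : ℕ) (j : Fin k' → ℕ) : Set (Fin k' → ℝ) :=
  Set.pi Set.univ fun i => Set.Ico ((j i : ℝ) / M) (((j i : ℝ) + 1) / M)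

/-- Half-open boxes lie in the closed boxes. [folklore] -/
theorem hoBox_subset_closedBox (j : Fin k' → ℕ) : hoBox M j ⊆ closedBox M j := fun _ ht i =>
  let h := ht i (Set.mem_univ i); ⟨h.1, h.2.le⟩

/-- Half-open boxes are measurable. [folklore] -/
theorem measurableSet_hoBox (j : Fin k' → ℕ) : MeasurableSet (hoBox M j) :=
  MeasurableSet.univ_pi fun _ => measurableSet_Ico

/-- A half-open box has volume `M^{-k'}`. [folklore] -/
theorem volume_hoBox_real (hM : 0 < M) (j : Fin k' → ℕ) : (volume (hoBox M j)).toReal = (1 / (M : ℝ)) ^ k' := by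
  rw [hoBox, Real.volume_pi_Ico_toReal]
  · rw [Finset.prod_congr rfl fun i _ => show ((j i : ℝ) + 1) / M - (j i : ℝ) / M = 1 / (M : ℝ) by ring,
      Finset.prod_const, Finset.card_univ, Fintype.card_fin]
  · intro i
    have : (0:ℝ) < M := by exact_mod_cast hM
    exact div_le_div_of_nonneg_right (by linarith) this.le

/-- Half-open boxes have finite volume. [folklore] -/
theorem volume_hoBox_lt_top (j : Fin k' → ℕ) : volume (hoBox M j) < ⊤ := by
  refine lt_of_le_of_lt (measure_mono (hoBox_subset_closedBox j)) ?_
  have : closedBox M j = Set.Icc (fun i => (j i : ℝ) / M) (fun i => ((j i : ℝ) + 1) / M) := by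
    ext t; simp [closedBox, Set.mem_Icc, Pi.le_def, forall_and]
  rw [this]
  exact measure_Icc_lt_top

/-- Distinct half-open boxes are disjoint. [folklore] -/
theorem pairwiseDisjoint_hoBox :
    (Set.univ : Set (Fin k' → ℕ)).Pairwise (Function.onFun Disjoint (hoBox (k' := k') M)) := by
  intro j _ j' _ hne
  rw [Function.onFun, Set.disjoint_left]
  intro t ht ht'
  apply hne
  funext i
  have h1 := ht i (Set.mem_univ i)
  have h2 := ht' i (Set.mem_univ i)
  -- `⌊M t_i⌋ = j i = j' i`
  rcases Nat.eq_zero_or_pos M with hM | hM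
  · subst hM
    simp only [Nat.cast_zero, div_zero, Set.mem_Ico] at h1
    exact absurd h1.2 (not_lt.2 h1.1)
  have hM' : (0:ℝ) < M := by exact_mod_cast hM
  rw [Set.mem_Ico, div_le_iff₀ hM', lt_div_iff₀ hM'] at h1 h2
  have e1 : ⌊t i * M⌋₊ = j i := Nat.floor_eq_iff (by nlinarith [h1.1, (Nat.cast_nonneg (j i) : (0:ℝ) ≤ j i)]) |>.2 ⟨h1.1, h1.2⟩
  have e2 : ⌊t i * M⌋₊ = j' i := Nat.floor_eq_iff (by nlinarith [h2.1, (Nat.cast_nonneg (j' i) : (0:ℝ) ≤ j' i)]) |>.2 ⟨h2.1, h2.2⟩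
  rw [← e1, ← e2]

/-- The half-open boxes of the cell vectors tile the half-open unit cube. [folklore] -/
theorem biUnion_hoBox (hM : 0 < M) :
    ⋃ j ∈ cellVecs k' M, hoBox M j = Set.pi Set.univ fun _ : Fin k' => Set.Ico (0:ℝ) 1 := by
  have hM' : (0:ℝ) < M := by exact_mod_cast hM
  ext t
  simp only [Set.mem_iUnion, exists_prop, hoBox, Set.mem_univ_pi, Set.mem_Ico]
  constructor
  · rintro ⟨j, hj, ht⟩ i
    have hji : j i < M := Finset.mem_range.1 (Fintype.mem_piFinset.1 hj i)
    obtain ⟨h1, h2⟩ := ht i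
    constructor
    · exact le_trans (by positivity) h1
    · refine lt_of_lt_of_le h2 ?_
      rw [div_le_one hM']
      exact_mod_cast Nat.succ_le_of_lt hji
  · intro ht
    refine ⟨fun i => ⌊t i * M⌋₊, ?_, fun i => ?_⟩
    · rw [cellVecs, Fintype.mem_piFinset]
      intro i
      rw [Finset.mem_range]
      have : t i * M < M := by nlinarith [(ht i).2, (ht i).1]
      exact (Nat.floor_lt (by nlinarith [(ht i).1])).2 (by exact_mod_cast this)
    · have h0 : 0 ≤ t i * M := by nlinarith [(ht i).1]
      constructor
      · rw [div_le_iff₀ hM']; exact Nat.floor_le h0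
      · rw [lt_div_iff₀ hM']; exact Nat.lt_floor_add_one _

/-- The integral over the unit cube is the sum of the integrals over the half-open boxes.
[folklore] -/
theorem integral_maynardCube_eq_sum (hM : 0 < M) {G : (Fin k' → ℝ) → ℝ}
    (hG : IntegrableOn G (maynardCube k') volume) :
    ∫ t in maynardCube k', G t = ∑ j ∈ cellVecs k' M, ∫ t in hoBox M j, G t := by
  have hae : (Set.pi Set.univ fun _ : Fin k' => Set.Ico (0:ℝ) 1) =ᵐ[volume] maynardCube k' := by
    rw [maynardCube, MeasureTheory.volume_pi]
    exact Measure.pi_Ico_ae_eq_pi_Icc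
  rw [← setIntegral_congr_set hae, ← biUnion_hoBox hM]
  refine integral_biUnion_finset _ (fun j _ => measurableSet_hoBox j)
    (pairwiseDisjoint_hoBox.mono (Set.subset_univ _)) fun j hj => hG.mono_set ?_
  -- `hoBox ⊆ maynardCube`
  intro t ht i _
  have hji : j i < M := Finset.mem_range.1 (Fintype.mem_piFinset.1 hj i)
  have hM' : (0:ℝ) < M := by exact_mod_cast hM
  obtain ⟨h1, h2⟩ := ht i (Set.mem_univ i)
  refine ⟨le_trans (by positivity) h1, le_trans h2.le ?_⟩
  rw [div_le_one hM']; exact_mod_cast Nat.succ_le_of_lt hji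

/-- A box integral of a function within `C` of a constant. [folklore] -/
theorem abs_setIntegral_hoBox_sub_le (hM : 0 < M) {G : (Fin k' → ℝ) → ℝ} {j : Fin k' → ℕ} {c C : ℝ}
    (hGint : IntegrableOn G (hoBox M j) volume) (hb : ∀ t ∈ hoBox M j, |G t - c| ≤ C) :
    |(∫ t in hoBox M j, G t) - c * (1 / (M : ℝ)) ^ k'| ≤ C * (1 / (M : ℝ)) ^ k' := by
  have hvol := volume_hoBox_real hM j
  have hconst : ∫ _ in hoBox M j, c = c * (1 / (M : ℝ)) ^ k' := by
    rw [setIntegral_const, smul_eq_mul, Measure.real, hvol, mul_comm]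
  rw [← hconst, ← integral_sub hGint ((integrableOn_const_iff).2 (Or.inr (volume_hoBox_lt_top j)))]
  have := norm_setIntegral_le_of_norm_le_const (volume_hoBox_lt_top j) (f := fun t => G t - c)
    (fun t ht => by rw [Real.norm_eq_abs]; exact hb t ht)
  rw [Real.norm_eq_abs, Measure.real, hvol] at this
  exact this

/-- **From the uniform grid to the integral**: with the classification of cells,
`|∑_j M^{-k'} v_j − ∫_{[0,1]^{k'}} G| ≤ ω + 2 Gmax #bad / M^{k'}`. [folklore] -/
theorem abs_uniform_sub_integral_le (hM : 0 < M) {G : (Fin k' → ℝ) → ℝ} {v : (Fin k' → ℕ) → ℝ}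
    {Good : (Fin k' → ℕ) → Prop} [DecidablePred Good] {ω Gmax : ℝ} (hω : 0 ≤ ω)
    (hG : IntegrableOn G (maynardCube k') volume)
    (hgood : ∀ j ∈ cellVecs k' M, Good j → ∀ t ∈ closedBox M j, |G t - v j| ≤ ω)
    (hv : ∀ j ∈ cellVecs k' M, |v j| ≤ Gmax)
    (hGb : ∀ j ∈ cellVecs k' M, ∀ t ∈ closedBox M j, |G t| ≤ Gmax) :
    |∑ j ∈ cellVecs k' M, (1 / (M : ℝ)) ^ k' * v j - ∫ t in maynardCube k', G t| ≤
      ω + 2 * Gmax * ((cellVecs k' M).filter (fun j => ¬Good j)).card * (1 / (M : ℝ)) ^ k' := by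
  have hM' : (0:ℝ) < M := by exact_mod_cast hM
  have hsub : ∀ j ∈ cellVecs k' M, hoBox M j ⊆ maynardCube k' := by
    intro j hj t ht i _
    have hji : j i < M := Finset.mem_range.1 (Fintype.mem_piFinset.1 hj i)
    obtain ⟨h1, h2⟩ := ht i (Set.mem_univ i)
    refine ⟨le_trans (by positivity) h1, le_trans h2.le ?_⟩
    rw [div_le_one hM']; exact_mod_cast Nat.succ_le_of_lt hji
  rw [integral_maynardCube_eq_sum hM hG, ← Finset.sum_sub_distrib]
  have hterm : ∀ j ∈ cellVecs k' M, |(1 / (M : ℝ)) ^ k' * v j - ∫ t in hoBox M j, G t| ≤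
      (if Good j then ω else 2 * Gmax) * (1 / (M : ℝ)) ^ k' := by
    intro j hj
    rw [abs_sub_comm, mul_comm]
    refine abs_setIntegral_hoBox_sub_le hM (hG.mono_set (hsub j hj)) fun t ht => ?_
    have ht' := hoBox_subset_closedBox j ht
    split_ifs with hg
    · exact hgood j hj hg t ht'
    · calc |G t - v j| ≤ |G t| + |v j| := abs_sub _ _
        _ ≤ 2 * Gmax := by linarith [hGb j hj t ht', hv j hj]
  calc _ ≤ ∑ j ∈ cellVecs k' M, |(1 / (M : ℝ)) ^ k' * v j - ∫ t in hoBox M j, G t| := Finset.abs_sum_le_sum_abs _ _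
    _ ≤ ∑ j ∈ cellVecs k' M, (if Good j then ω else 2 * Gmax) * (1 / (M : ℝ)) ^ k' := Finset.sum_le_sum hterm
    _ = ω * ((cellVecs k' M).filter Good).card * (1 / (M : ℝ)) ^ k' +
          2 * Gmax * ((cellVecs k' M).filter (fun j => ¬Good j)).card * (1 / (M : ℝ)) ^ k' := by
        rw [← Finset.sum_filter_add_sum_filter_not (cellVecs k' M) Good]
        congr 1
        · rw [Finset.sum_congr rfl fun j hj => by rw [if_pos (Finset.mem_filter.1 hj).2], Finset.sum_const,
            nsmul_eq_mul]; ring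
        · rw [Finset.sum_congr rfl fun j hj => by rw [if_neg (Finset.mem_filter.1 hj).2], Finset.sum_const,
            nsmul_eq_mul]; ring
    _ ≤ ω * (cellVecs k' M).card * (1 / (M : ℝ)) ^ k' +
          2 * Gmax * ((cellVecs k' M).filter (fun j => ¬Good j)).card * (1 / (M : ℝ)) ^ k' := by
        gcongr
        exact Finset.filter_subset _ _
    _ = _ := by
        rw [cellVecs, Fintype.card_piFinset]
        simp only [Finset.card_range, Finset.prod_const, Finset.card_univ, Fintype.card_fin]
        push_cast
        rw [mul_assoc ω, ← mul_pow, mul_one_div_cancel hM'.ne', one_pow, mul_one]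

end Integral


/-! ### Cells versus a polytope `{t ∈ [0,1]^{k'} : ∑_{i ∈ S_l} tᵢ ≤ 1 ∀ l}` -/

section Polytope

open MeasureTheory Set

variable {k' : ℕ} {M : ℕ} {ι : Type*} [Fintype ι] (S : ι → Finset (Fin k'))

/-- The polytope cut out of the unit cube by the constraints `∑_{i ∈ S l} tᵢ ≤ 1` (for the simplex
`R_k`: one constraint `S = univ`; for the `J`-integrand: two constraints). [cite: MaynardAnnals2015, Proposition 4.1 (R_k)] -/
def polytope : Set (Fin k' → ℝ) := {t | t ∈ maynardCube k' ∧ ∀ l, ∑ i ∈ S l, t i ≤ 1}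

/-- A cell is inside the polytope. [folklore] -/
def InsideCell (M : ℕ) (j : Fin k' → ℕ) : Prop := ∀ l, ∑ i ∈ S l, (j i + 1) ≤ M

/-- A cell is outside the polytope. [folklore] -/
def OutsideCell (M : ℕ) (j : Fin k' → ℕ) : Prop := ∃ l, M < ∑ i ∈ S l, j i

/-- Decidability. [folklore] -/
instance (M : ℕ) (j : Fin k' → ℕ) : Decidable (InsideCell S M j) := by unfold InsideCell; infer_instance
/-- Decidability. [folklore] -/
instance (M : ℕ) (j : Fin k' → ℕ) : Decidable (OutsideCell S M j) := by unfold OutsideCell; infer_instance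

variable {S}

omit [Fintype ι] in
/-- Membership in the polytope. [folklore] -/
theorem mem_polytope {t : Fin k' → ℝ} : t ∈ polytope S ↔ t ∈ maynardCube k' ∧ ∀ l, ∑ i ∈ S l, t i ≤ 1 := Iff.rfl

/-- With the single constraint `S = univ` the polytope is Maynard's simplex `R_k`. [cite: MaynardAnnals2015, Proposition 4.1 (R_k)] -/
theorem polytope_univ_eq_maynardSimplex (k' : ℕ) :
    polytope (fun _ : Unit => (Finset.univ : Finset (Fin k'))) = maynardSimplex k' := by
  ext t
  rw [mem_polytope]
  simp only [forall_const, maynardSimplex, Set.mem_setOf_eq, maynardCube, Set.mem_univ_pi, Set.mem_Icc]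
  constructor
  · rintro ⟨hc, hs⟩; exact ⟨fun i => (hc i).1, hs⟩
  · rintro ⟨h0, hs⟩
    refine ⟨fun i => ⟨h0 i, le_trans ?_ hs⟩, hs⟩
    exact Finset.single_le_sum (fun j _ => h0 j) (Finset.mem_univ i)

/-- Closed boxes of cell vectors lie in the unit cube. [folklore] -/
theorem closedBox_subset_maynardCube (hM : 0 < M) {j : Fin k' → ℕ} (hj : j ∈ cellVecs k' M) :
    closedBox M j ⊆ maynardCube k' := by
  intro t ht i _
  have hM' : (0:ℝ) < M := by exact_mod_cast hM
  have hji : j i < M := Finset.mem_range.1 (Fintype.mem_piFinset.1 hj i)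
  obtain ⟨h1, h2⟩ := ht i
  refine ⟨le_trans (by positivity) h1, le_trans h2 ?_⟩
  rw [div_le_one hM']; exact_mod_cast Nat.succ_le_of_lt hji

omit [Fintype ι] in
/-- Inside cells lie in the polytope. [folklore] -/
theorem closedBox_subset_polytope (hM : 0 < M) {j : Fin k' → ℕ} (hj : j ∈ cellVecs k' M)
    (hin : InsideCell S M j) : closedBox M j ⊆ polytope S := by
  intro t ht
  have hM' : (0:ℝ) < M := by exact_mod_cast hM
  refine ⟨closedBox_subset_maynardCube hM hj ht, fun l => ?_⟩
  calc ∑ i ∈ S l, t i ≤ ∑ i ∈ S l, ((j i : ℝ) + 1) / M := Finset.sum_le_sum fun i _ => (ht i).2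
    _ = (∑ i ∈ S l, ((j i : ℝ) + 1)) / M := by rw [Finset.sum_div]
    _ ≤ 1 := by
        rw [div_le_one hM']
        have := hin l
        exact_mod_cast this

omit [Fintype ι] in
/-- Outside cells miss the polytope. [folklore] -/
theorem not_mem_polytope_of_outsideCell (hM : 0 < M) {j : Fin k' → ℕ} (hout : OutsideCell S M j)
    {t : Fin k' → ℝ} (ht : t ∈ closedBox M j) : t ∉ polytope S := by
  rintro ⟨-, hcon⟩
  obtain ⟨l, hl⟩ := hout
  have hM' : (0:ℝ) < M := by exact_mod_cast hM
  have h1 : ∑ i ∈ S l, (j i : ℝ) / M ≤ ∑ i ∈ S l, t i := Finset.sum_le_sum fun i _ => (ht i).1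
  rw [← Finset.sum_div, div_le_iff₀ hM'] at h1
  have h2 := hcon l
  have : (M : ℝ) < ∑ i ∈ S l, (j i : ℝ) := by exact_mod_cast hl
  nlinarith

/-- **Counting the boundary cells**: cells neither inside nor outside number at most
`(∑_l (|S_l| + 1)) M^{k'−1}` (the fibres `∑_{S_l} j = s`, `M − |S_l| ≤ s ≤ M`, each of size
`≤ M^{k'−1}`). [folklore] -/
theorem card_filter_not_good_le (hM : 0 < M) :
    ((cellVecs k' M).filter (fun j => ¬(InsideCell S M j ∨ OutsideCell S M j))).card ≤
      (∑ l, ((S l).card + 1)) * M ^ (k' - 1) := by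
  classical
  -- a bad cell has, for some `l`, `M − |S l| < ∑_{S l} j ≤ M`
  have hsub : (cellVecs k' M).filter (fun j => ¬(InsideCell S M j ∨ OutsideCell S M j)) ⊆
      (Finset.univ : Finset ι).biUnion fun l => (Finset.Icc (M - (S l).card) M).biUnion fun s =>
        (cellVecs k' M).filter (fun j => ∑ i ∈ S l, j i = s) := by
    intro j hj
    rw [Finset.mem_filter, not_or] at hj
    obtain ⟨hjc, hnin, hnout⟩ := hj
    unfold InsideCell at hnin; unfold OutsideCell at hnout
    push Not at hnin hnout
    obtain ⟨l, hl⟩ := hnin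
    simp only [Finset.mem_biUnion, Finset.mem_univ, true_and, Finset.mem_Icc, Finset.mem_filter]
    refine ⟨l, ∑ i ∈ S l, j i, ⟨?_, hnout l⟩, hjc, rfl⟩
    rw [Finset.sum_add_distrib, Finset.sum_const, smul_eq_mul, mul_one] at hl
    omega
  refine (Finset.card_le_card hsub).trans ?_
  refine (Finset.card_biUnion_le).trans ?_
  rw [Finset.sum_mul]
  refine Finset.sum_le_sum fun l _ => (Finset.card_biUnion_le).trans ?_
  -- each fibre `{∑_{S l} j = s}` has at most `M^{k'-1}` elements (and `S l ≠ ∅` if the fibre matters)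
  rcases (S l).eq_empty_or_nonempty with hS | ⟨i₀, hi₀⟩
  · -- empty constraint: the fibres `{0 = s}`, `s ∈ Icc M M`, are empty as `M > 0`
    rw [hS]
    simp only [Finset.card_empty, Nat.sub_zero, Finset.Icc_self, Finset.sum_singleton, Finset.sum_empty,
      zero_add, one_mul]
    rw [Finset.filter_eq_empty_iff.2 (fun j _ => by omega), Finset.card_empty]
    exact Nat.zero_le _
  have hfib : ∀ s, ((cellVecs k' M).filter (fun j => ∑ i ∈ S l, j i = s)).card ≤ M ^ (k' - 1) := by
    intro s
    -- inject into the tuples vanishing at `i₀`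
    have hk : 0 < k' := Fin.pos i₀
    set Z : Finset (Fin k' → ℕ) := Fintype.piFinset fun i => if i = i₀ then {0} else Finset.range M with hZ
    have hZcard : Z.card = M ^ (k' - 1) := by
      rw [hZ, Fintype.card_piFinset]
      rw [show (∏ i, (if i = i₀ then ({0} : Finset ℕ) else Finset.range M).card) =
          ∏ i, (if i = i₀ then 1 else M) from Finset.prod_congr rfl fun i _ => by
            split_ifs <;> simp,
        Finset.prod_ite, Finset.prod_const_one, one_mul, Finset.prod_const, Finset.filter_ne',
        Finset.card_erase_of_mem (Finset.mem_univ i₀), Finset.card_univ, Fintype.card_fin]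
    rw [← hZcard]
    refine Finset.card_le_card_of_injOn (fun j => Function.update j i₀ 0) (fun j hj => ?_) ?_
    · rw [Finset.mem_coe, Finset.mem_filter] at hj
      rw [Finset.mem_coe, hZ, Fintype.mem_piFinset]
      intro i
      dsimp only
      by_cases hi : i = i₀
      · subst hi; simp
      · rw [Function.update_of_ne hi, if_neg hi]
        exact Fintype.mem_piFinset.1 hj.1 i
    · intro j hj j' hj' heq
      rw [Finset.mem_coe, Finset.mem_filter] at hj hj'
      dsimp only at heq
      funext i
      by_cases hi : i = i₀
      · subst hi
        -- the `i₀`-coordinate is determined by the fibre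
        have h1 := hj.2; have h2 := hj'.2
        rw [← Finset.add_sum_erase _ _ hi₀] at h1 h2
        have hrest : ∑ x ∈ (S l).erase i, j x = ∑ x ∈ (S l).erase i, j' x := by
          refine Finset.sum_congr rfl fun x hx => ?_
          have hx' : x ≠ i := Finset.ne_of_mem_erase hx
          have := congrFun heq x
          rwa [Function.update_of_ne hx', Function.update_of_ne hx'] at this
        omega
      · have := congrFun heq i
        rwa [Function.update_of_ne hi, Function.update_of_ne hi] at this
  calc ∑ s ∈ Finset.Icc (M - (S l).card) M, ((cellVecs k' M).filter (fun j => ∑ i ∈ S l, j i = s)).card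
      ≤ ∑ s ∈ Finset.Icc (M - (S l).card) M, M ^ (k' - 1) := Finset.sum_le_sum fun s _ => hfib s
    _ = (Finset.Icc (M - (S l).card) M).card * M ^ (k' - 1) := by rw [Finset.sum_const, smul_eq_mul]
    _ ≤ ((S l).card + 1) * M ^ (k' - 1) := by
        refine Nat.mul_le_mul_right _ ?_
        rw [Nat.card_Icc]; omega

/-- The corner `(jᵢ/M)ᵢ` of a cell. [folklore] -/
noncomputable def corner (M : ℕ) (j : Fin k' → ℕ) : Fin k' → ℝ := fun i => (j i : ℝ) / M

/-- The corner lies in the closed box. [folklore] -/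
theorem corner_mem_closedBox (hM : 0 < M) (j : Fin k' → ℕ) : corner M j ∈ closedBox M j := by
  intro i
  have hM' : (0:ℝ) < M := by exact_mod_cast hM
  exact ⟨le_rfl, div_le_div_of_nonneg_right (by linarith) hM'.le⟩

/-- **Classification of cells for `G = g · 1_{polytope}`**: on inside/outside cells `G` is within
`ω` of `v j` (`g` at the corner, resp. `0`), where `ω` is the oscillation of `g` at scale `1/M`.
[folklore] -/
theorem classify_cells (hM : 0 < M) {g : (Fin k' → ℝ) → ℝ} {ω Gmax : ℝ} (hGmax : 0 ≤ Gmax)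
    (hcont : ∀ t ∈ maynardCube k', ∀ t' ∈ maynardCube k', (∀ i, |t i - t' i| ≤ 1 / (M : ℝ)) → |g t - g t'| ≤ ω)
    (hgb : ∀ t ∈ maynardCube k', |g t| ≤ Gmax) :
    (∀ j ∈ cellVecs k' M, (InsideCell S M j ∨ OutsideCell S M j) → ∀ t ∈ closedBox M j,
        |(polytope S).indicator g t - (if InsideCell S M j then g (corner M j) else 0)| ≤ ω) ∧
    (∀ j ∈ cellVecs k' M, |(if InsideCell S M j then g (corner M j) else 0)| ≤ Gmax) ∧
    (∀ j ∈ cellVecs k' M, ∀ t ∈ closedBox M j, |(polytope S).indicator g t| ≤ Gmax) := by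
  classical
  have hM' : (0:ℝ) < M := by exact_mod_cast hM
  have hω : 0 ≤ ω := by
    -- from `hcont` at any point of the cube, e.g. `0`
    have h0 : (fun _ => (0:ℝ)) ∈ maynardCube k' := fun i _ => ⟨le_rfl, zero_le_one⟩
    have := hcont _ h0 _ h0 (fun i => by simp)
    simpa using this
  refine ⟨fun j hj hgood t ht => ?_, fun j hj => ?_, fun j hj t ht => ?_⟩
  · by_cases hin : InsideCell S M j
    · rw [if_pos hin, Set.indicator_of_mem (closedBox_subset_polytope hM hj hin ht)]
      refine hcont t (closedBox_subset_maynardCube hM hj ht) _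
        (closedBox_subset_maynardCube hM hj (corner_mem_closedBox hM j)) fun i => ?_
      have := ht i
      rw [corner, abs_le]
      constructor <;> linarith [this.1, this.2, show ((j i : ℝ) + 1) / M = (j i : ℝ) / M + 1 / M by ring]
    · have hout : OutsideCell S M j := hgood.resolve_left hin
      rw [if_neg hin, Set.indicator_of_notMem (not_mem_polytope_of_outsideCell hM hout ht), sub_zero, abs_zero]
      exact hω
  · split_ifs
    · exact hgb _ (closedBox_subset_maynardCube hM hj (corner_mem_closedBox hM j))
    · rw [abs_zero]; exact hGmax
  · by_cases hmem : t ∈ polytope S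
    · rw [Set.indicator_of_mem hmem]; exact hgb t (closedBox_subset_maynardCube hM hj ht)
    · rw [Set.indicator_of_notMem hmem, abs_zero]; exact hGmax

end Polytope


/-! ### The equidistribution estimate -/

section Main

open MeasureTheory Set

variable {k' : ℕ} {R : ℝ} {M : ℕ} {ι : Type*} [Fintype ι]

/-- **Equidistribution of product weights against a cut-off continuous function** (the tree's
replacement for the `k` applications of Maynard's Lemma 6.1 in the proofs of Lemmas 6.2 and 6.3):
if each one-dimensional weight has counting function `c log y (1 + O(ε)) + O(E)`, then for
`G = g · 1_{polytope}` with `g` continuous on the cube (oscillation `ω` at scale `1/M`, bound `Gmax`),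
`Σ = ∑_u (∏ wtᵢ(uᵢ)) G(log uᵢ/log R) = (c log R)^{k'} (∫_{[0,1]^{k'}} G + error)` with an explicit
error in terms of `M`, `ω`, `η = 2M(ε + E/(c log R))`. [cite: MaynardAnnals2015, proofs of Lemmas 6.2–6.3 (main terms)] -/
theorem abs_weightedSum_sub_integral_le (hk : 0 < k') (S : ι → Finset (Fin k'))
    {wt : Fin k' → ℕ → ℝ} (hwt : ∀ i u, 0 ≤ wt i u) {c ε E : ℝ} (hc : 0 < c) (hε : 0 ≤ ε) (hE : 0 ≤ E)
    (hH : ∀ i, ∀ y : ℝ, 1 ≤ y → |massUpTo (wt i) ⌊y⌋₊ - c * Real.log y| ≤ ε * c * Real.log y + E)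
    (hR : 1 < R) (hM : 0 < M) {g : (Fin k' → ℝ) → ℝ} {ω Gmax : ℝ} (hω : 0 ≤ ω) (hGmax : 0 ≤ Gmax)
    (hcont : ∀ t ∈ maynardCube k', ∀ t' ∈ maynardCube k', (∀ i, |t i - t' i| ≤ 1 / (M : ℝ)) → |g t - g t'| ≤ ω)
    (hgb : ∀ t ∈ maynardCube k', |g t| ≤ Gmax)
    (hint : IntegrableOn ((polytope S).indicator g) (maynardCube k') volume) :
    |weightedSum wt R ((polytope S).indicator g) -
        (c * Real.log R) ^ k' * ∫ t in maynardCube k', (polytope S).indicator g t| ≤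
      (c * Real.log R) ^ k' *
        (((1 + 2 * M * (ε + E / (c * Real.log R))) ^ k' + 1) *
            (ω + 2 * Gmax * (∑ l, ((S l).card + 1 : ℝ)) / M) +
          Gmax * ((1 + 2 * M * (ε + E / (c * Real.log R))) ^ k' - 1)) := by
  classical
  have hlogR : 0 < Real.log R := Real.log_pos hR
  have hM' : (0:ℝ) < M := by exact_mod_cast hM
  set Λ := c * Real.log R with hΛ
  have hΛ0 : 0 < Λ := mul_pos hc hlogR
  set a := Λ / M with ha
  have ha0 : 0 < a := div_pos hΛ0 hM'
  set η := 2 * M * (ε + E / Λ) with hη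
  have hη0 : 0 ≤ η := by positivity
  set G := (polytope S).indicator g with hG
  set v : (Fin k' → ℕ) → ℝ := fun j => if InsideCell S M j then g (corner M j) else 0 with hv
  set L' : ℝ := ∑ l, ((S l).card + 1 : ℝ) with hL'
  have hL'0 : 0 ≤ L' := Finset.sum_nonneg fun l _ => by positivity
  -- (i) cell masses
  have hmass : ∀ i, ∀ j < M, |cellMass (wt i) R M j - a| ≤ η * a := by
    intro i j hj
    have := abs_cellMass_sub_le hc.le hε (hH i) hR hM hj
    have e1 : a = c * Real.log R / M := by rw [ha, hΛ]
    have e2 : η * a = 2 * (ε * c * Real.log R + E) := by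
      rw [hη, ha, hΛ]; field_simp
    rw [e1, ← ha, e2] at *
    rw [← e1]; exact this
  -- (ii) the classification of cells
  obtain ⟨hgood, hvb, hGb⟩ := classify_cells (S := S) hM hGmax hcont hgb
  have hNbad : (((cellVecs k' M).filter (fun j => ¬(InsideCell S M j ∨ OutsideCell S M j))).card : ℝ) *
      (1 / (M : ℝ)) ^ k' ≤ L' / M := by
    have h1 : (((cellVecs k' M).filter (fun j => ¬(InsideCell S M j ∨ OutsideCell S M j))).card : ℝ) ≤
        L' * (M : ℝ) ^ (k' - 1) := by
      have := card_filter_not_good_le (S := S) (k' := k') hM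
      rw [hL']
      exact_mod_cast this
    calc _ ≤ L' * (M : ℝ) ^ (k' - 1) * (1 / (M : ℝ)) ^ k' := by gcongr
      _ = L' / M := by
          obtain ⟨n, rfl⟩ : ∃ n, k' = n + 1 := ⟨k' - 1, by omega⟩
          rw [Nat.add_sub_cancel, pow_succ, one_div, inv_pow]
          field_simp
  -- total mass bounds
  have hsum_all : ∑ j ∈ cellVecs k' M, ∏ i, cellMass (wt i) R M (j i) ≤ (1 + η) ^ k' * Λ ^ k' := by
    calc _ ≤ ∑ j ∈ cellVecs k' M, ((1 + η) * a) ^ k' :=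
          Finset.sum_le_sum fun j hj => prod_cellMass_le hwt hmass hj
      _ = (M : ℝ) ^ k' * ((1 + η) * a) ^ k' := by
          rw [Finset.sum_const, nsmul_eq_mul, cellVecs, Fintype.card_piFinset]
          simp [Finset.card_univ, Fintype.card_fin]
      _ = (1 + η) ^ k' * Λ ^ k' := by rw [ha, mul_pow, div_pow]; field_simp
  have hsum_bad : ∑ j ∈ (cellVecs k' M).filter (fun j => ¬(InsideCell S M j ∨ OutsideCell S M j)),
      ∏ i, cellMass (wt i) R M (j i) ≤ (1 + η) ^ k' * Λ ^ k' * (L' / M) := by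
    calc _ ≤ ∑ j ∈ (cellVecs k' M).filter (fun j => ¬(InsideCell S M j ∨ OutsideCell S M j)), ((1 + η) * a) ^ k' :=
          Finset.sum_le_sum fun j hj => prod_cellMass_le hwt hmass (Finset.mem_filter.1 hj).1
      _ = (((cellVecs k' M).filter (fun j => ¬(InsideCell S M j ∨ OutsideCell S M j))).card : ℝ) *
            (1 / (M : ℝ)) ^ k' * ((1 + η) ^ k' * Λ ^ k') := by
          rw [Finset.sum_const, nsmul_eq_mul, ha, mul_pow, div_pow, one_div, inv_pow]
          field_simp
      _ ≤ L' / M * ((1 + η) ^ k' * Λ ^ k') := by gcongr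
      _ = _ := by ring
  -- (iii) the three comparisons
  have E1 := abs_weightedSum_sub_grid_le (v := v) hwt hω hR hM hgood hvb hGb
  have E2 := abs_grid_sub_uniform_le (v := v) ha0.le hη0 hmass hvb
  have E3 := abs_uniform_sub_integral_le (v := v) hM hω hint hgood hvb hGb
  -- (iv) rewrite the uniform grid sum as `Λ^{k'} ∑ (1/M)^{k'} v`
  have huni : ∑ j ∈ cellVecs k' M, a ^ k' * v j = Λ ^ k' * ∑ j ∈ cellVecs k' M, (1 / (M : ℝ)) ^ k' * v j := by
    rw [Finset.mul_sum]
    refine Finset.sum_congr rfl fun j _ => ?_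
    rw [ha, div_pow, one_div, inv_pow]; field_simp
  -- combine
  have hE3' : |Λ ^ k' * ∑ j ∈ cellVecs k' M, (1 / (M : ℝ)) ^ k' * v j - Λ ^ k' * ∫ t in maynardCube k', G t| ≤
      Λ ^ k' * (ω + 2 * Gmax * L' / M) := by
    rw [← mul_sub, abs_mul, abs_of_pos (pow_pos hΛ0 _)]
    refine mul_le_mul_of_nonneg_left (E3.trans ?_) (pow_pos hΛ0 _).le
    rw [mul_assoc, mul_div_assoc]
    gcongr
  have hE1' : |weightedSum wt R G - ∑ j ∈ cellVecs k' M, (∏ i, cellMass (wt i) R M (j i)) * v j| ≤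
      (1 + η) ^ k' * Λ ^ k' * (ω + 2 * Gmax * L' / M) := by
    refine E1.trans ?_
    calc ω * ∑ j ∈ cellVecs k' M, ∏ i, cellMass (wt i) R M (j i) +
          2 * Gmax * ∑ j ∈ (cellVecs k' M).filter (fun j => ¬(InsideCell S M j ∨ OutsideCell S M j)),
            ∏ i, cellMass (wt i) R M (j i)
        ≤ ω * ((1 + η) ^ k' * Λ ^ k') + 2 * Gmax * ((1 + η) ^ k' * Λ ^ k' * (L' / M)) := by gcongr
      _ = _ := by ring
  have hE2' : |∑ j ∈ cellVecs k' M, (∏ i, cellMass (wt i) R M (j i)) * v j -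
      Λ ^ k' * ∑ j ∈ cellVecs k' M, (1 / (M : ℝ)) ^ k' * v j| ≤ Gmax * ((1 + η) ^ k' - 1) * Λ ^ k' := by
    rw [← huni]
    refine E2.trans (le_of_eq ?_)
    rw [ha, div_pow]; field_simp
  calc |weightedSum wt R G - Λ ^ k' * ∫ t in maynardCube k', G t|
      ≤ |weightedSum wt R G - ∑ j ∈ cellVecs k' M, (∏ i, cellMass (wt i) R M (j i)) * v j| +
        |∑ j ∈ cellVecs k' M, (∏ i, cellMass (wt i) R M (j i)) * v j -
          Λ ^ k' * ∑ j ∈ cellVecs k' M, (1 / (M : ℝ)) ^ k' * v j| +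
        |Λ ^ k' * ∑ j ∈ cellVecs k' M, (1 / (M : ℝ)) ^ k' * v j - Λ ^ k' * ∫ t in maynardCube k', G t| := by
          have := abs_sub_le (weightedSum wt R G) (∑ j ∈ cellVecs k' M, (∏ i, cellMass (wt i) R M (j i)) * v j)
            (Λ ^ k' * ∫ t in maynardCube k', G t)
          have := abs_sub_le (∑ j ∈ cellVecs k' M, (∏ i, cellMass (wt i) R M (j i)) * v j)
            (Λ ^ k' * ∑ j ∈ cellVecs k' M, (1 / (M : ℝ)) ^ k' * v j) (Λ ^ k' * ∫ t in maynardCube k', G t)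
          linarith
    _ ≤ (1 + η) ^ k' * Λ ^ k' * (ω + 2 * Gmax * L' / M) + Gmax * ((1 + η) ^ k' - 1) * Λ ^ k' +
          Λ ^ k' * (ω + 2 * Gmax * L' / M) := add_le_add (add_le_add hE1' hE2') hE3'
    _ = Λ ^ k' * ((((1 + η) ^ k' + 1) * (ω + 2 * Gmax * L' / M)) + Gmax * ((1 + η) ^ k' - 1)) := by ring

end Main

end MaynardTao
end Literature.NumberTheory.Sieve
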